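import Mathlib
import Summits.Ventures.PercRepro2.Defs
import Summits.Ventures.PercRepro2.Independence
import Summits.Ventures.PercRepro2.Harris
import Summits.Ventures.PercRepro2.Graph
import Summits.Ventures.PercRepro2.Events
import Summits.Ventures.PercRepro2.ZCClusterBlind
import Summits.Ventures.PercRepro2.ZCRootDecomp
import Summits.Ventures.PercRepro2.ZCCondProb
import Summits.Ventures.PercRepro2.ZCThetaPA
import Summits.Ventures.PercRepro2.CondAvoidPA
import Summits.Ventures.PercRepro2.ZCDirectCube
import Summits.Ventures.PercRepro2.ZCDirectFibre
import Summits.Ventures.PercRepro2.ZCDirectInfluence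
import Summits.Ventures.PercRepro2.ZCDirectFun
import Summits.Ventures.PercRepro2.ZCDirectMain
import Summits.Ventures.PercRepro2.ZCDirectLift
import Summits.Ventures.PercRepro2.ZCDirectFunMain

/-!
# Row 2′ZC ⟸ `(ZC-between)`: the (ZC) expression of a cluster up-set dominates its between-plus-influence
form (blind cell PercRepro2, mine-a g29; MINE-A.md §83.5, §83.9, §83.11)

For the cluster up-set `U = {C(a₁) ∈ 𝓔}` of the root, split `ω = glue σ₁ τ` (`σ₁` = the configuration of
`G − a₁`, `τ` = the edges of `a₁`).  Over each `σ₁` the fibre `U_σ₁ = {τ ∣ glue σ₁ τ ∈ U}` is an up-set of `τ`,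
so the cube step (`fibre_step_fun`) and the influence identity (`fib_cov_eq_fun`) apply to its indicator
`u_σ₁`: the within part of the (ZC) expression is at least

  `∑_{σ₁} w₁(σ₁)·(S·m(σ₁) − b)·P(Xᶜ_σ₁)·I_{u_σ₁}(C'(a₃))`   (the INFLUENCE term `T3'`),

and the law of total covariance leaves the BETWEEN term
`S·Cov_{σ₁}(ū, xw) − b·Cov_{σ₁}(ū, x)` (the `ThetaPA` form at `ū(σ₁) = P(U ∣ σ₁)`).  Hence
`Z(U) ≥ T3' + between` (`zc_ge_between`), and **if `T3' + between ≥ 0` — the conjecture `(ZC-between)`,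
exact census 0 / 43,040 + 0 / 23,904 at pendant roots, Bernstein-positive in the attachment probabilities
(0 / 2,436,972 coefficients) — then (ZC) holds** (`zc_of_between`).  Unlike `ThetaPA` and `(ZC-N)`, the
hypothesis survives the pendant-root test: its first-order coefficient is a Harris covariance (§83.10).
-/

namespace Summit.Ventures.PercRepro2

namespace ZCDirect

variable {V : Type*} {E : Type*} [Fintype V] [DecidableEq V] [Fintype E] [DecidableEq E]
  {R : Type*} [Field R] [LinearOrder R] [IsStrictOrderedRing R]

variable (ends : E → Sym2 V) (a₁ : V)

section Between

variable (p : E → R)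

/-- **The between-plus-influence lower bound** for the (ZC) expression of a cluster up-set. -/
theorem zc_ge_between (hp : IsProbVec p) {𝓔 : Set (Set V)} (h𝓔 : IsUpperSet 𝓔) {a₃ o : V}
    (h3 : a₃ ≠ a₁) (ho : o ≠ a₁) :
    let e := connEvent ends a₁ a₃
    let L := connEvent ends a₁ o
    let γ := connEvent ends a₃ o
    let U := clusterInEvent ends a₁ 𝓔
    let S := prob p (eᶜ ∩ Lᶜ)
    let b := prob p (eᶜ ∩ Lᶜ ∩ γ)
    let p₁ : {e // e ∈ awayEdges ends a₁} → R := fun i => p i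
    let p₂ : {e // e ∉ awayEdges ends a₁} → R := fun i => p i
    let ubar : ({e // e ∈ awayEdges ends a₁} → Bool) → R := fun σ₁ => prob p₂ (fib ends a₁ U σ₁)
    let xw : ({e // e ∈ awayEdges ends a₁} → Bool) → R :=
      fun σ₁ => prob p₂ (fib ends a₁ e σ₁ ∩ fib ends a₁ L σ₁)
    let x : ({e // e ∈ awayEdges ends a₁} → Bool) → R := fun σ₁ => prob p₂ (fib ends a₁ e σ₁)
    (∑ σ₁ : {e // e ∈ awayEdges ends a₁} → Bool, weight p₁ σ₁ *
        ((S * mConst ends a₁ p σ₁ a₃ o - b) * prob p₂ (fib ends a₁ e σ₁)ᶜ *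
          IpropF ends a₁ p ((fib ends a₁ U σ₁).indicator 1)
            (cluster ends (baseConfig ends a₁ σ₁) a₃))) +
      (S * (∑ σ₁ : {e // e ∈ awayEdges ends a₁} → Bool, weight p₁ σ₁ * (ubar σ₁ * xw σ₁) -
          (∑ σ₁ : {e // e ∈ awayEdges ends a₁} → Bool, weight p₁ σ₁ * ubar σ₁) *
            (∑ σ₁ : {e // e ∈ awayEdges ends a₁} → Bool, weight p₁ σ₁ * xw σ₁)) -
        b * (∑ σ₁ : {e // e ∈ awayEdges ends a₁} → Bool, weight p₁ σ₁ * (ubar σ₁ * x σ₁) -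
          (∑ σ₁ : {e // e ∈ awayEdges ends a₁} → Bool, weight p₁ σ₁ * ubar σ₁) *
            (∑ σ₁ : {e // e ∈ awayEdges ends a₁} → Bool, weight p₁ σ₁ * x σ₁))) ≤
      S * (prob p (U ∩ (e ∩ L)) - prob p U * prob p (e ∩ L)) -
        b * (prob p (U ∩ e) - prob p U * prob p e) := by
  intro e L γ U S b p₁ p₂ ubar xw x
  classical
  have hp₂ : IsProbVec p₂ := ⟨fun i => hp.nonneg i, fun i => hp.le_one i⟩
  have hp₁ : IsProbVec p₁ := ⟨fun i => hp.nonneg i, fun i => hp.le_one i⟩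
  have hw₁ : ∀ σ₁, 0 ≤ weight p₁ σ₁ := fun σ₁ => weight_nonneg hp₁ σ₁
  have hS0 : 0 ≤ S := prob_nonneg hp _
  have hU : IsUpperSet U := isUpperSet_clusterInEvent ends a₁ h𝓔
  -- the tower identities
  have hUeL : prob p (U ∩ (e ∩ L)) = ∑ σ₁ : {e // e ∈ awayEdges ends a₁} → Bool, weight p₁ σ₁ *
      prob p₂ (fib ends a₁ U σ₁ ∩ (fib ends a₁ e σ₁ ∩ fib ends a₁ L σ₁)) :=
    prob_eq_sum_fib ends a₁ p _
  have hUe : prob p (U ∩ e) = ∑ σ₁ : {e // e ∈ awayEdges ends a₁} → Bool, weight p₁ σ₁ *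
      prob p₂ (fib ends a₁ U σ₁ ∩ fib ends a₁ e σ₁) := prob_eq_sum_fib ends a₁ p _
  have hPU : prob p U = ∑ σ₁ : {e // e ∈ awayEdges ends a₁} → Bool, weight p₁ σ₁ * ubar σ₁ :=
    prob_eq_sum_fib ends a₁ p _
  have hPeL : prob p (e ∩ L) = ∑ σ₁ : {e // e ∈ awayEdges ends a₁} → Bool, weight p₁ σ₁ * xw σ₁ :=
    prob_eq_sum_fib ends a₁ p _
  have hPe : prob p e = ∑ σ₁ : {e // e ∈ awayEdges ends a₁} → Bool, weight p₁ σ₁ * x σ₁ :=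
    prob_eq_sum_fib ends a₁ p _
  -- the per-fibre covariance combination and its lower bound
  have hfib : ∀ σ₁ : {e // e ∈ awayEdges ends a₁} → Bool,
      (S * mConst ends a₁ p σ₁ a₃ o - b) * prob p₂ (fib ends a₁ e σ₁)ᶜ *
          IpropF ends a₁ p ((fib ends a₁ U σ₁).indicator 1)
            (cluster ends (baseConfig ends a₁ σ₁) a₃) ≤
        S * (prob p₂ (fib ends a₁ U σ₁ ∩ (fib ends a₁ e σ₁ ∩ fib ends a₁ L σ₁)) -
            ubar σ₁ * xw σ₁) -
          b * (prob p₂ (fib ends a₁ U σ₁ ∩ fib ends a₁ e σ₁) - ubar σ₁ * x σ₁) := by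
    intro σ₁
    set u : ({e // e ∉ awayEdges ends a₁} → Bool) → R := (fib ends a₁ U σ₁).indicator 1 with hu
    have hum : Monotone u := monotone_indicator_of_isUpperSet (R := R) (isUpperSet_fib ends a₁ hU σ₁)
    have hu0 : ∀ τ, 0 ≤ u τ := fun τ => Set.indicator_nonneg (fun _ _ => zero_le_one) τ
    have hstep := fibre_step_fun ends a₁ p hp hum hu0 σ₁ h3 ho (S := S) (b := b) hS0
    simp only [] at hstep
    have hcov := fib_cov_eq_fun ends a₁ p u σ₁ h3
    -- rewrite the expectations of `u · 1_A` as probabilities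
    have h1 : expect p₂ (fun τ => u τ * (fib ends a₁ e σ₁ ∩ fib ends a₁ L σ₁).indicator 1 τ) =
        prob p₂ (fib ends a₁ U σ₁ ∩ (fib ends a₁ e σ₁ ∩ fib ends a₁ L σ₁)) :=
      expect_indicator_mul_indicator p₂ _ _
    have h2 : expect p₂ (fun τ => u τ * (fib ends a₁ e σ₁).indicator 1 τ) =
        prob p₂ (fib ends a₁ U σ₁ ∩ fib ends a₁ e σ₁) := expect_indicator_mul_indicator p₂ _ _
    have h3' : expect p₂ u = ubar σ₁ := (prob_eq_expect_indicator p₂ _).symm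
    rw [h1, h2, h3'] at hstep
    rw [h2, h3'] at hcov
    rw [mul_assoc, ← hcov]
    exact hstep
  -- assemble: the sum of the lower bounds, plus the between term, is the (ZC) expression
  have hsum := Finset.sum_le_sum fun σ₁ (_ : σ₁ ∈ Finset.univ) =>
    mul_le_mul_of_nonneg_left (hfib σ₁) (hw₁ σ₁)
  have hident : S * (prob p (U ∩ (e ∩ L)) - prob p U * prob p (e ∩ L)) -
      b * (prob p (U ∩ e) - prob p U * prob p e) =
      (∑ σ₁ : {e // e ∈ awayEdges ends a₁} → Bool, weight p₁ σ₁ *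
        (S * (prob p₂ (fib ends a₁ U σ₁ ∩ (fib ends a₁ e σ₁ ∩ fib ends a₁ L σ₁)) -
            ubar σ₁ * xw σ₁) -
          b * (prob p₂ (fib ends a₁ U σ₁ ∩ fib ends a₁ e σ₁) - ubar σ₁ * x σ₁))) +
      (S * (∑ σ₁ : {e // e ∈ awayEdges ends a₁} → Bool, weight p₁ σ₁ * (ubar σ₁ * xw σ₁) -
          (∑ σ₁ : {e // e ∈ awayEdges ends a₁} → Bool, weight p₁ σ₁ * ubar σ₁) *
            (∑ σ₁ : {e // e ∈ awayEdges ends a₁} → Bool, weight p₁ σ₁ * xw σ₁)) -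
        b * (∑ σ₁ : {e // e ∈ awayEdges ends a₁} → Bool, weight p₁ σ₁ * (ubar σ₁ * x σ₁) -
          (∑ σ₁ : {e // e ∈ awayEdges ends a₁} → Bool, weight p₁ σ₁ * ubar σ₁) *
            (∑ σ₁ : {e // e ∈ awayEdges ends a₁} → Bool, weight p₁ σ₁ * x σ₁))) := by
    have hexp : ∑ σ₁ : {e // e ∈ awayEdges ends a₁} → Bool, weight p₁ σ₁ *
        (S * (prob p₂ (fib ends a₁ U σ₁ ∩ (fib ends a₁ e σ₁ ∩ fib ends a₁ L σ₁)) -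
            ubar σ₁ * xw σ₁) -
          b * (prob p₂ (fib ends a₁ U σ₁ ∩ fib ends a₁ e σ₁) - ubar σ₁ * x σ₁)) =
        S * ∑ σ₁ : {e // e ∈ awayEdges ends a₁} → Bool, weight p₁ σ₁ *
            prob p₂ (fib ends a₁ U σ₁ ∩ (fib ends a₁ e σ₁ ∩ fib ends a₁ L σ₁)) -
          S * ∑ σ₁ : {e // e ∈ awayEdges ends a₁} → Bool, weight p₁ σ₁ * (ubar σ₁ * xw σ₁) -
          b * ∑ σ₁ : {e // e ∈ awayEdges ends a₁} → Bool, weight p₁ σ₁ *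
            prob p₂ (fib ends a₁ U σ₁ ∩ fib ends a₁ e σ₁) +
          b * ∑ σ₁ : {e // e ∈ awayEdges ends a₁} → Bool, weight p₁ σ₁ * (ubar σ₁ * x σ₁) := by
      rw [Finset.mul_sum, Finset.mul_sum, Finset.mul_sum, Finset.mul_sum, ← Finset.sum_sub_distrib,
        ← Finset.sum_sub_distrib, ← Finset.sum_add_distrib]
      exact Finset.sum_congr rfl fun σ₁ _ => by ring
    rw [hexp, hUeL, hUe, hPU, hPeL, hPe]
    ring
  rw [hident]
  linarith [hsum]

/-- **Row 2′ZC ⟸ `(ZC-between)`**: if the between-plus-influence form is nonnegative, (ZC) holds for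
the cluster up-set `{C(a₁) ∈ 𝓔}`. -/
theorem zc_of_between (hp : IsProbVec p) {𝓔 : Set (Set V)} (h𝓔 : IsUpperSet 𝓔) {a₃ o : V}
    (h3 : a₃ ≠ a₁) (ho : o ≠ a₁)
    (hB : let e := connEvent ends a₁ a₃
      let L := connEvent ends a₁ o
      let γ := connEvent ends a₃ o
      let U := clusterInEvent ends a₁ 𝓔
      let S := prob p (eᶜ ∩ Lᶜ)
      let b := prob p (eᶜ ∩ Lᶜ ∩ γ)
      let p₁ : {e // e ∈ awayEdges ends a₁} → R := fun i => p i
      let p₂ : {e // e ∉ awayEdges ends a₁} → R := fun i => p i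
      let ubar : ({e // e ∈ awayEdges ends a₁} → Bool) → R := fun σ₁ => prob p₂ (fib ends a₁ U σ₁)
      let xw : ({e // e ∈ awayEdges ends a₁} → Bool) → R :=
        fun σ₁ => prob p₂ (fib ends a₁ e σ₁ ∩ fib ends a₁ L σ₁)
      let x : ({e // e ∈ awayEdges ends a₁} → Bool) → R := fun σ₁ => prob p₂ (fib ends a₁ e σ₁)
      0 ≤ (∑ σ₁ : {e // e ∈ awayEdges ends a₁} → Bool, weight p₁ σ₁ *
          ((S * mConst ends a₁ p σ₁ a₃ o - b) * prob p₂ (fib ends a₁ e σ₁)ᶜ *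
            IpropF ends a₁ p ((fib ends a₁ U σ₁).indicator 1)
              (cluster ends (baseConfig ends a₁ σ₁) a₃))) +
        (S * (∑ σ₁ : {e // e ∈ awayEdges ends a₁} → Bool, weight p₁ σ₁ * (ubar σ₁ * xw σ₁) -
            (∑ σ₁ : {e // e ∈ awayEdges ends a₁} → Bool, weight p₁ σ₁ * ubar σ₁) *
              (∑ σ₁ : {e // e ∈ awayEdges ends a₁} → Bool, weight p₁ σ₁ * xw σ₁)) -
          b * (∑ σ₁ : {e // e ∈ awayEdges ends a₁} → Bool, weight p₁ σ₁ * (ubar σ₁ * x σ₁) -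
            (∑ σ₁ : {e // e ∈ awayEdges ends a₁} → Bool, weight p₁ σ₁ * ubar σ₁) *
              (∑ σ₁ : {e // e ∈ awayEdges ends a₁} → Bool, weight p₁ σ₁ * x σ₁)))) :
    let e := connEvent ends a₁ a₃
    let L' := connEvent ends a₁ o
    let γ := connEvent ends a₃ o
    let U := clusterInEvent ends a₁ 𝓔
    0 ≤ prob p (eᶜ ∩ L'ᶜ ∩ γᶜ) * (prob p (U ∩ (e ∩ L')) - prob p U * prob p (e ∩ L'))
      - prob p (eᶜ ∩ L'ᶜ ∩ γ) * (prob p (U ∩ (e ∩ L'ᶜ)) - prob p U * prob p (e ∩ L'ᶜ)) := by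
  intro e L' γ U
  have hmain := zc_ge_between ends a₁ p hp h𝓔 h3 ho
  simp only [] at hmain hB
  have hUe : prob p (U ∩ (e ∩ L'ᶜ)) = prob p (U ∩ e) - prob p (U ∩ (e ∩ L')) := by
    have := prob_inter_add_prob_inter_compl p (U ∩ e) L'
    rw [Set.inter_assoc, Set.inter_assoc] at this
    linarith
  have he : prob p (e ∩ L'ᶜ) = prob p e - prob p (e ∩ L') := by
    have := prob_inter_add_prob_inter_compl p e L'
    linarith
  have hSbd : prob p (eᶜ ∩ L'ᶜ) = prob p (eᶜ ∩ L'ᶜ ∩ γ) + prob p (eᶜ ∩ L'ᶜ ∩ γᶜ) :=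
    (prob_inter_add_prob_inter_compl p (eᶜ ∩ L'ᶜ) γ).symm
  rw [hUe, he]
  have hrew : prob p (eᶜ ∩ L'ᶜ ∩ γᶜ) * (prob p (U ∩ (e ∩ L')) - prob p U * prob p (e ∩ L')) -
      prob p (eᶜ ∩ L'ᶜ ∩ γ) * (prob p (U ∩ e) - prob p (U ∩ (e ∩ L')) -
        prob p U * (prob p e - prob p (e ∩ L'))) =
      prob p (eᶜ ∩ L'ᶜ) * (prob p (U ∩ (e ∩ L')) - prob p U * prob p (e ∩ L')) -
        prob p (eᶜ ∩ L'ᶜ ∩ γ) * (prob p (U ∩ e) - prob p U * prob p e) := by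
    rw [hSbd]; ring
  rw [hrew]
  exact le_trans hB hmain

end Between

end ZCDirect

end Summit.Ventures.PercRepro2
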